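import Mathlib
import Summits.CriticalPhenomena.PercolationContinuityZ3.Theorems.PercNearOneGluingAdditiveGluingBystanderCluster
import HarnessLib

/-! # Crux `PercNearOneGluing.AdditiveGluing` (stmt-CriticalPhenomena-4576), line `subuniform-dead-pocket-maximum`,
# stub `stub_goodStep` — the pocket-augmented BHK inequality, I: partition of unity and Markov property

Helper file for the crux (prover-siege k9, variation "C1 kernel first").  The kernel C1 of `stub_goodStep`
(lead c1, `Cruxes/AdditiveGluing/Lines/subuniform-dead-pocket-maximum-goodstep-c1.md` §3) follows from a
correlation inequality of van den Berg–Häggström–Kahn type for the NON-monotone "pocket event"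
`F = {o ↔ s} ∪ {C(o) ∈ P}` of an observer `o` (`P` any predicate on vertex sets), proved in the sequel files
`…PocketBHKStep.lean` / `…PocketBHK.lean` (`pocketCore`).  Framework: the finite-sum formalism of
`Literature.Probability.Percolation.BHK2006` (`weight`, `ind`, `rC`, `rD`, `rS`, `edgesIn`, `meeting`) and the
observer-cluster toolkit of `…BystanderCluster.lean` (siege k42, namespace `BystanderBHK`: the observer's vertex
cluster `openCluster (ω ∩ edgesIn U) o`, conditioning on `{C(o) = W}`, its Markov property `sum_ind_rK_mul`),
reused, not re-proved.  This file adds the bookkeeping the base case of the inequality needs: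
* the finite family of POCKETS `U.powerset.filter (o ∈ · ∧ s ∉ ·)` (possible `s`-free values of `C(o)`),
  the partition of unity `1 = 1{o ↔ s} + Σ_W 1{C(o) = W}` (`ind_reach_add_sum_pockets`) and the expansion of
  `1_F` along it (`ind_rF_eq`);
* the Markov property specialised to the source's side (`pocket_sum`, registered sub-goal
  `stub_pocketMarkov_k9`): `E[1{C(o)=W} · H(C_s^U) 1{s ↮ X in G[U]}] = P(C(o)=W) · E[H(C_s^{U∖W}) 1{s ↮ X in
  G[U∖W]}]` for `W ∌ s` — on `{C(o) = W}` the source's cluster lives in `G[U ∖ W]`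
  (`BystanderBHK.rC_restrict_rK`, `BystanderBHK.mem_rD_iff_rK`), then `BystanderBHK.sum_ind_rK_mul`.
No definitions; no new mathematics beyond bookkeeping. -/

namespace Summit.CriticalPhenomena.PercolationContinuityZ3.Theorems

namespace PocketBHK

open Literature.Probability.Percolation Literature.Probability.Percolation.BHK2006
open DecisionTree (ind ind_of_mem ind_of_not_mem ind_nonneg)
open scoped Classical

noncomputable section

variable {V : Type*}

/-! ### Pockets -/

/-- Membership in the family of pockets `{W ⊆ U | o ∈ W, s ∉ W}`. [folklore] -/
theorem mem_pockets {U W : Finset V} {o s : V} :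
    W ∈ (U.powerset.filter fun W => o ∈ W ∧ s ∉ W) ↔ W ⊆ U ∧ o ∈ W ∧ s ∉ W := by
  simp only [Finset.mem_filter, Finset.mem_powerset]

/-- The observer's cluster in `G[U]` lies in `U` (for `o ∈ U`). [folklore] -/
theorem rK_subset {U : Finset V} {o : V} (hoU : o ∈ U) (ω : Set (Sym2 V)) :
    openCluster (ω ∩ edgesIn U) o ⊆ ↑U := by
  intro v hv
  change (openGraph (ω ∩ edgesIn U)).Reachable o v at hv
  rw [SimpleGraph.reachable_iff_reflTransGen] at hv
  induction hv with
  | refl => exact hoU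
  | tail _ hbc _ => exact (adj_iff.1 hbc).2.1.2

/-- In `G[U ∖ W]` the source `s ∉ W` reaches no vertex of `W`, so forbidding `X` or `X ∖ W` is the same
event. [folklore] -/
theorem rD_sdiff_sdiff_eq {U W : Finset V} {s : V} (hsW : s ∉ W) (X : Set V) :
    rD (U \ W) s (X \ ↑W) = rD (U \ W) s X := by
  ext ω
  refine ⟨fun h x hx hr => ?_, fun h x hx hr => h x hx.1 hr⟩
  by_cases hxW : x ∈ W
  · rw [SimpleGraph.reachable_iff_reflTransGen] at hr
    cases hr with
    | refl => exact hsW hxW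
    | tail _ hbc => exact (Finset.mem_sdiff.1 (adj_iff.1 hbc).2.1.2).2 hxW
  · exact h x ⟨hx, hxW⟩ hr

variable [Fintype V]

/-- **Spatial Markov property of the observer's cluster, source side** (finite-sum form): for `W ∌ s`,
`E[1{C(o) = W} · H(C_s^U) · 1{s ↮ X in G[U]}] = P(C(o) = W) · E[H(C_s^{U∖W}) · 1{s ↮ X in G[U∖W]}]`
(`BystanderBHK.sum_ind_rK_mul` after rewriting the integrand on the event). [folklore] -/
theorem pocket_sum {U W : Finset V} {o s : V} (hsW : s ∉ W) (w : Sym2 V → ℝ)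
    (hm : ∑ ω, weight w ω = 1) (H : Set (Sym2 V) → ℝ) (X : Set V) :
    ∑ ω, weight w ω * (ind {ω | openCluster (ω ∩ edgesIn U) o = ↑W} ω * (H (rC U s ω) * ind (rD U s X) ω)) =
      (∑ ω, weight w ω * ind {ω | openCluster (ω ∩ edgesIn U) o = ↑W} ω) *
        ∑ η, weight w η * (H (rC (U \ W) s η) * ind (rD (U \ W) s X) η) := by
  have hΨ : ∀ ω, H (rC (U \ W) s (ω \ meeting W)) * ind (rD (U \ W) s X) (ω \ meeting W) =
      H (rC (U \ W) s ω) * ind (rD (U \ W) s X) ω := fun ω => by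
    rw [rC_diff_meeting, BystanderBHK.ind_congr (mem_rD_diff_meeting U W s X ω)]
  rw [← BystanderBHK.sum_ind_rK_mul w hm U W o _ hΨ]
  refine Finset.sum_congr rfl fun ω _ => ?_
  by_cases hK : openCluster (ω ∩ edgesIn U) o = ↑W
  · rw [BystanderBHK.rC_restrict_rK hK hsW, BystanderBHK.ind_congr (BystanderBHK.mem_rD_iff_rK hK hsW X),
      rD_sdiff_sdiff_eq hsW]
  · rw [ind_of_not_mem (show ω ∉ {ω | openCluster (ω ∩ edgesIn U) o = ↑W} from hK), zero_mul, zero_mul]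

/-! ### Partition of unity along the observer's cluster -/

/-- The observer's cluster as a finset. [folklore] -/
theorem coe_filter_mem_rK (U : Finset V) (o : V) (ω : Set (Sym2 V)) :
    (↑(Finset.univ.filter fun v => v ∈ openCluster (ω ∩ edgesIn U) o) : Set V) =
      openCluster (ω ∩ edgesIn U) o := by
  ext v; simp

/-- **Partition of unity**: `1 = 1{o ↔ s in G[U]} + Σ_{W pocket} 1{C(o) = W}` (for `o ∈ U`). [folklore] -/
theorem ind_reach_add_sum_pockets {U : Finset V} {o : V} (hoU : o ∈ U) (s : V) (ω : Set (Sym2 V)) :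
    ind {ω | (openGraph (ω ∩ edgesIn U)).Reachable o s} ω +
      ∑ W ∈ (U.powerset.filter fun W => o ∈ W ∧ s ∉ W),
        ind {ω | openCluster (ω ∩ edgesIn U) o = ↑W} ω = 1 := by
  by_cases hr : (openGraph (ω ∩ edgesIn U)).Reachable o s
  · rw [ind_of_mem (show ω ∈ {ω | (openGraph (ω ∩ edgesIn U)).Reachable o s} from hr)]
    rw [Finset.sum_eq_zero fun W hW => ?_]
    · ring
    refine ind_of_not_mem fun h : openCluster (ω ∩ edgesIn U) o = ↑W => (mem_pockets.1 hW).2.2 ?_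
    exact Finset.mem_coe.1 (h ▸ (hr : s ∈ openCluster (ω ∩ edgesIn U) o))
  · rw [ind_of_not_mem (show ω ∉ {ω | (openGraph (ω ∩ edgesIn U)).Reachable o s} from hr), zero_add]
    set K₀ : Finset V := Finset.univ.filter fun v => v ∈ openCluster (ω ∩ edgesIn U) o with hK₀
    have hK₀c : (↑K₀ : Set V) = openCluster (ω ∩ edgesIn U) o := coe_filter_mem_rK U o ω
    have hK₀m : K₀ ∈ (U.powerset.filter fun W => o ∈ W ∧ s ∉ W) := by
      refine mem_pockets.2 ⟨fun v hv => ?_, ?_, fun h => hr ?_⟩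
      · exact rK_subset hoU ω (hK₀c ▸ Finset.mem_coe.2 hv)
      · exact Finset.mem_coe.1 (hK₀c.symm ▸ mem_openCluster_self _ o)
      · exact (hK₀c ▸ Finset.mem_coe.2 h : s ∈ openCluster (ω ∩ edgesIn U) o)
    rw [Finset.sum_eq_single_of_mem K₀ hK₀m fun W _ hW => ?_]
    · exact ind_of_mem (show ω ∈ {ω | openCluster (ω ∩ edgesIn U) o = ↑K₀} from hK₀c.symm)
    · exact ind_of_not_mem fun h : openCluster (ω ∩ edgesIn U) o = ↑W =>
        hW (Finset.coe_inj.1 (hK₀c.trans h)).symm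

/-- **Expansion of the pocket event** `F = {o ↔ s} ∪ {C(o) ∈ P}`:
`1_F = 1{o ↔ s} + Σ_{W pocket, P W} 1{C(o) = W}` (for `o ∈ U`; any predicate `P`). [folklore] -/
theorem ind_rF_eq {U : Finset V} {o : V} (hoU : o ∈ U) (s : V) (P : Set V → Prop) (ω : Set (Sym2 V)) :
    ind {ξ | (openGraph (ξ ∩ edgesIn U)).Reachable o s ∨ P (openCluster (ξ ∩ edgesIn U) o)} ω =
      ind {ω | (openGraph (ω ∩ edgesIn U)).Reachable o s} ω +
      ∑ W ∈ (U.powerset.filter fun W => o ∈ W ∧ s ∉ W).filter (fun W : Finset V => P (↑W : Set V)),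
        ind {ω | openCluster (ω ∩ edgesIn U) o = ↑W} ω := by
  set F : Set (Set (Sym2 V)) :=
    {ξ | (openGraph (ξ ∩ edgesIn U)).Reachable o s ∨ P (openCluster (ξ ∩ edgesIn U) o)} with hF
  by_cases hr : (openGraph (ω ∩ edgesIn U)).Reachable o s
  · rw [ind_of_mem (show ω ∈ F from Or.inl hr),
      ind_of_mem (show ω ∈ {ω | (openGraph (ω ∩ edgesIn U)).Reachable o s} from hr)]
    rw [Finset.sum_eq_zero fun W hW => ?_]
    · ring
    refine ind_of_not_mem fun h : openCluster (ω ∩ edgesIn U) o = ↑W =>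
      (mem_pockets.1 (Finset.mem_filter.1 hW).1).2.2 ?_
    exact Finset.mem_coe.1 (h ▸ (hr : s ∈ openCluster (ω ∩ edgesIn U) o))
  · rw [ind_of_not_mem (show ω ∉ {ω | (openGraph (ω ∩ edgesIn U)).Reachable o s} from hr), zero_add]
    set K₀ : Finset V := Finset.univ.filter fun v => v ∈ openCluster (ω ∩ edgesIn U) o with hK₀
    have hK₀c : (↑K₀ : Set V) = openCluster (ω ∩ edgesIn U) o := coe_filter_mem_rK U o ω
    have hK₀m : K₀ ∈ (U.powerset.filter fun W => o ∈ W ∧ s ∉ W) := by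
      refine mem_pockets.2 ⟨fun v hv => ?_, ?_, fun h => hr ?_⟩
      · exact rK_subset hoU ω (hK₀c ▸ Finset.mem_coe.2 hv)
      · exact Finset.mem_coe.1 (hK₀c.symm ▸ mem_openCluster_self _ o)
      · exact (hK₀c ▸ Finset.mem_coe.2 h : s ∈ openCluster (ω ∩ edgesIn U) o)
    by_cases hP : P (openCluster (ω ∩ edgesIn U) o)
    · rw [ind_of_mem (show ω ∈ F from Or.inr hP)]
      have hmem : K₀ ∈ (U.powerset.filter fun W => o ∈ W ∧ s ∉ W).filter
          (fun W : Finset V => P (↑W : Set V)) :=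
        Finset.mem_filter.2 ⟨hK₀m, hK₀c.symm ▸ hP⟩
      rw [Finset.sum_eq_single_of_mem K₀ hmem fun W _ hW => ?_]
      · exact (ind_of_mem (show ω ∈ {ω | openCluster (ω ∩ edgesIn U) o = ↑K₀} from hK₀c.symm)).symm
      · exact ind_of_not_mem fun h : openCluster (ω ∩ edgesIn U) o = ↑W =>
          hW (Finset.coe_inj.1 (hK₀c.trans h)).symm
    · rw [ind_of_not_mem (show ω ∉ F from fun h => h.elim hr hP)]
      symm
      refine Finset.sum_eq_zero fun W hW => ?_
      refine ind_of_not_mem fun h : openCluster (ω ∩ edgesIn U) o = ↑W => hP ?_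
      rw [h]
      exact (Finset.mem_filter.1 hW).2

end

end PocketBHK

open scoped Classical in
/-- **Registered sub-goal `stub_pocketMarkov_k9` of `stub_goodStep` (siege k9): the spatial Markov property of
the observer's cluster, source side** (= `PocketBHK.pocket_sum`, closed form over the BHK2006 finite-sum
framework): for product weights `w` of total mass `1` and `W ⊆ U` with `s ∉ W`,
`E[1{C_U(o) = W} · H(C_s^U) · 1{s ↮ X in G[U]}] = P(C_U(o) = W) · E[H(C_s^{U∖W}) · 1{s ↮ X in G[U∖W]}]`.
[folklore] -/
theorem stub_pocketMarkov_k9 : ∀ (V : Type) [Fintype V] (w : Sym2 V → ℝ),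
    ∑ ω, Literature.Probability.Percolation.BHK2006.weight w ω = 1 →
    ∀ (U W : Finset V) (o s : V), W ⊆ U → s ∉ W → ∀ (H : Set (Sym2 V) → ℝ) (X : Set V),
    ∑ ω, Literature.Probability.Percolation.BHK2006.weight w ω *
        (Literature.Probability.Percolation.DecisionTree.ind {ω : Set (Sym2 V) |
            Literature.Probability.Percolation.openCluster
              (ω ∩ Literature.Probability.Percolation.BHK2006.edgesIn U) o = ↑W} ω *
          (H (Literature.Probability.Percolation.BHK2006.rC U s ω) *
            Literature.Probability.Percolation.DecisionTree.ind
              (Literature.Probability.Percolation.BHK2006.rD U s X) ω)) =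
      (∑ ω, Literature.Probability.Percolation.BHK2006.weight w ω *
          Literature.Probability.Percolation.DecisionTree.ind {ω : Set (Sym2 V) |
            Literature.Probability.Percolation.openCluster
              (ω ∩ Literature.Probability.Percolation.BHK2006.edgesIn U) o = ↑W} ω) *
        ∑ η, Literature.Probability.Percolation.BHK2006.weight w η *
          (H (Literature.Probability.Percolation.BHK2006.rC (U \ W) s η) *
            Literature.Probability.Percolation.DecisionTree.ind
              (Literature.Probability.Percolation.BHK2006.rD (U \ W) s X) η) :=
  fun _ _ w hm _ _ _ _ _ hsW H X => PocketBHK.pocket_sum hsW w hm H X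

end Summit.CriticalPhenomena.PercolationContinuityZ3.Theorems
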